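/-
COR-CM (cell pub-hodgecm2, stage 2 of the Hodge ladder) — count-neutral KERNEL COMBINATORICS «index-two descent of abstract CM types: the dictionary»
(seat prover-pub-hodgecm2-b23-g41-0, binder prover b23, gen 41; claim QUARTIC-TRANSPORT, CLAIM-ADDENDUM #1 «INDEX-TWO DESCENT», HOME/INBOX.md l.10136).
Bookkeeping definitions with bodies (`res₀`, `res₁`, `glue`, `typePairEquiv`) + theorems, on top of the intrinsic currency `CorCM/Prior/AllgGroup1.lean` /
`Census/BlockParityLaw.lean` used BY NAME; no `decide`, no certificate, no named fact, no `sorry`; `Interfaces.lean` (C1), every E term, B01,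
`Transposition/*`, `PortJoin/*` untouched.
HONEST FRAMING: `HC_CM` is NOT proved, here or anywhere in the tree; nothing here is a period, a count of record or a headline.
T5: n/a-class (hypothesis binders: `c ∈ H`, `c` central, `x ∉ H`, `H.index = 2` only); checker: self, 2026-08-23.
-/
import Summits.HodgeConjecture.CorCM.Census.BlockParityLaw

/-!
# Index-two descent of abstract CM types, I: the dictionary `CMF G c ≃ CMF H c × CMF H c`

Let `G` be a finite group, `c ∈ G` a CENTRAL involution, `H ≤ G` a subgroup of INDEX TWO containing `c`, and `x ∈ G ∖ H` (so `G = H ⊔ xH`).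
An abstract CM type `Ψ` of `(G, c)` (`Ψ ⊔ cΨ = G`) restricts to the two cosets:

  `res₀ Ψ = Ψ ∩ H` and `res₁ Ψ = x⁻¹(Ψ ∩ xH) = {h ∈ H | x·h ∈ Ψ}`,

both abstract CM types of `(H, c)`, and conversely two types `Ψ₀, Ψ₁` of `(H, c)` glue to `glue Ψ₀ Ψ₁ = Ψ₀ ⊔ x·Ψ₁`; this is the bijection
**`typePairEquiv : CMF G c ≃ CMF H c × CMF H c`** (§2) — seat b09's «GENERAL REMARK» of the octic road map
(`HOME/pub-hodgecm2-b09/lean-g32/QUARTIC-TWIST.md` PART VI: «the octic type space is the SQUARE of the quartic one») in the intrinsic currency, for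
EVERY index-two subgroup through `c`: the `2^{j+1}`-ic twists `ℤ/2^{j+1} × B ⊃ ℤ/2^j × B`, the dicyclic / generalised-quaternion / twisted-dihedral /
`ℤ/2m × ℤ/2` types over their cyclic subgroup of index two, `Q₈ ⊃ ℤ/4`, … .

* §1 the coset calculus of an index-two subgroup (`inv_mul_mem_of_not_mem`, `mul_not_mem_of_not_mem`, …);
* §2 `res₀`, `res₁`, `glue`, `typePairEquiv` and their membership lemmas (`coe_mem_iff`, `mul_mem_iff`, `mem_glue_coe`, `mem_glue_mul`);
* §3 **base change along `H` is diagonal** (`res₀_rt_coe`, `res₁_rt_coe`), in particular conjugation (`res₀_rt_self`, `res₁_rt_self`); base change along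
  `x` swaps the coordinates up to `x`-conjugation and an `x²`-shift (`coe_mem_res₀_rt_iff`, `mem_res₁_rt_iff`, raw forms);
* §4 **flips**: a flip at a place of `H` flips the `0`-coordinate only (`res₀_oflipCM_coe`, `res₁_oflipCM_coe`), a flip at a place of `xH` flips the
  `1`-coordinate only (`res₀_oflipCM_mul`, `res₁_oflipCM_mul`) — so a rank-four face of `G` is a face of `H` in one coordinate (both places in one
  coset) or a MIXED square (one place in each coset); part II (`Census/IndexTwoDescentHodge.lean`) draws the consequences for `hodgeSpan`.

## References
* [Pohlmann1968] H. Pohlmann, Algebraic cycles on abelian varieties of complex multiplication type, Ann. of Math. 88 (1968), Thm 1.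
-/

namespace Summit.HodgeConjecture.CorCM.Census.IndexTwoDescent

open Finset
open Summit.HodgeConjecture.CorCM.Prior.AllgGroup.RfwfAllgGroup
open Summit.HodgeConjecture.CorCM.Census.BlockParity

noncomputable section

variable {G : Type*} [Group G] [Fintype G] [DecidableEq G] {c : G}
variable {H : Subgroup G} [DecidablePred (· ∈ H)]

/-! ## §1 Coset calculus of an index-two subgroup -/

omit [Fintype G] [DecidableEq G] [DecidablePred (· ∈ H)] in
/-- For `H` of index two and `x ∉ H`: `x⁻¹·g ∈ H ↔ g ∉ H`. [folklore] -/
theorem inv_mul_mem_iff_not_mem (hH : H.index = 2) {x : G} (hx : x ∉ H) (g : G) : x⁻¹ * g ∈ H ↔ g ∉ H := by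
  rw [Subgroup.mul_mem_iff_of_index_two hH, H.inv_mem_iff]
  tauto

omit [Fintype G] [DecidableEq G] [DecidablePred (· ∈ H)] in
/-- For `H` of index two and `x ∉ H`: `x·g ∈ H ↔ g ∉ H`. [folklore] -/
theorem mul_mem_iff_not_mem (hH : H.index = 2) {x : G} (hx : x ∉ H) (g : G) : x * g ∈ H ↔ g ∉ H := by
  rw [Subgroup.mul_mem_iff_of_index_two hH]
  tauto

omit [Fintype G] [DecidableEq G] [DecidablePred (· ∈ H)] in
/-- `x·h ∉ H` for `h ∈ H`, `x ∉ H`. [folklore] -/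
theorem mul_coe_not_mem {x : G} (hx : x ∉ H) (h : H) : x * (h : G) ∉ H := by
  intro hxh
  have h' := H.mul_mem hxh (H.inv_mem h.2)
  rw [mul_inv_cancel_right] at h'
  exact hx h'

omit [Fintype G] [DecidableEq G] [DecidablePred (· ∈ H)] in
/-- `c·g ∈ H ↔ g ∈ H` for `c ∈ H`. [folklore] -/
theorem cmul_mem_iff (hcH : c ∈ H) (g : G) : c * g ∈ H ↔ g ∈ H :=
  ⟨fun h => by simpa using H.mul_mem (H.inv_mem hcH) h, fun h => H.mul_mem hcH h⟩

omit [Fintype G] [DecidableEq G] [DecidablePred (· ∈ H)] in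
/-- The involution restricted to `H` is an involution. [folklore] -/
theorem csub_mul_csub (hcH : c ∈ H) (hc2 : c * c = 1) : (⟨c, hcH⟩ : H) * ⟨c, hcH⟩ = 1 :=
  Subtype.ext (by simpa using hc2)

omit [Fintype G] [DecidableEq G] [DecidablePred (· ∈ H)] in
/-- The involution restricted to `H` is central in `H`. [folklore] -/
theorem csub_comm (hcH : c ∈ H) (hcen : ∀ g : G, g * c = c * g) (h : H) : h * ⟨c, hcH⟩ = ⟨c, hcH⟩ * h :=
  Subtype.ext (by simpa using hcen h)

omit [Fintype G] [DecidableEq G] [DecidablePred (· ∈ H)] in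
/-- The involution restricted to `H` is not `1`. [folklore] -/
theorem csub_ne_one (hcH : c ∈ H) (hc1 : c ≠ 1) : (⟨c, hcH⟩ : H) ≠ 1 :=
  fun h => hc1 (by simpa using congrArg Subtype.val h)

/-! ## §2 Restriction to the two cosets and gluing -/

/-- **The `H`-part** of an abstract CM type: `res₀ Ψ = Ψ ∩ H`, a CM type of `(H, c)`. [folklore] -/
def res₀ (hcH : c ∈ H) (Ψ : CMF G c) : CMF H ⟨c, hcH⟩ :=
  ⟨univ.filter fun h : H => (h : G) ∈ Ψ.1, fun h => by
    simp only [mem_filter, mem_univ, true_and, Subgroup.coe_mul]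
    exact Ψ.2 h⟩

/-- **The `xH`-part** of an abstract CM type, read on `H`: `res₁ Ψ = {h | x·h ∈ Ψ} = x⁻¹(Ψ ∩ xH)`, a CM type of `(H, c)` (`c` central).
[folklore] -/
def res₁ (hcH : c ∈ H) (hcen : ∀ g : G, g * c = c * g) (x : G) (Ψ : CMF G c) : CMF H ⟨c, hcH⟩ :=
  ⟨univ.filter fun h : H => x * (h : G) ∈ Ψ.1, fun h => by
    simp only [mem_filter, mem_univ, true_and, Subgroup.coe_mul]
    rw [← mul_assoc, hcen x, mul_assoc]
    exact Ψ.2 (x * h)⟩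

/-- Membership in the `H`-part: `h ∈ res₀ Ψ ↔ h ∈ Ψ`. [folklore] -/
@[simp] theorem mem_res₀ (hcH : c ∈ H) (Ψ : CMF G c) (h : H) : h ∈ (res₀ hcH Ψ).1 ↔ (h : G) ∈ Ψ.1 := by
  simp [res₀]

/-- Membership in the `xH`-part: `h ∈ res₁ Ψ ↔ x·h ∈ Ψ`. [folklore] -/
@[simp] theorem mem_res₁ (hcH : c ∈ H) (hcen : ∀ g : G, g * c = c * g) (x : G) (Ψ : CMF G c) (h : H) :
    h ∈ (res₁ hcH hcen x Ψ).1 ↔ x * (h : G) ∈ Ψ.1 := by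
  simp [res₁]

omit [Fintype G] [DecidableEq G] [DecidablePred (· ∈ H)] in
/-- On `H` the gluing predicate `g ∈ Ψ₀ ⊔ x·Ψ₁` reads `Ψ₀`. [folklore] -/
theorem glueMem_coe_iff (hH : H.index = 2) {x : G} (hx : x ∉ H) (Ψ₀ Ψ₁ : Finset H) (h : H) :
    ((∃ hg : (h : G) ∈ H, (⟨(h : G), hg⟩ : H) ∈ Ψ₀) ∨ (∃ hg : x⁻¹ * (h : G) ∈ H, (⟨x⁻¹ * (h : G), hg⟩ : H) ∈ Ψ₁)) ↔ h ∈ Ψ₀ := by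
  constructor
  · rintro (⟨hg, hm⟩ | ⟨hg, -⟩)
    · simpa using hm
    · exact absurd hg (by rw [inv_mul_mem_iff_not_mem hH hx]; exact fun hn => hn h.2)
  · exact fun hm => Or.inl ⟨h.2, by simpa using hm⟩

omit [Fintype G] [DecidableEq G] [DecidablePred (· ∈ H)] in
/-- On `xH` the gluing predicate `g ∈ Ψ₀ ⊔ x·Ψ₁` reads `Ψ₁`. [folklore] -/
theorem glueMem_mul_iff {x : G} (hx : x ∉ H) (Ψ₀ Ψ₁ : Finset H) (h : H) :
    ((∃ hg : x * (h : G) ∈ H, (⟨x * (h : G), hg⟩ : H) ∈ Ψ₀) ∨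
      (∃ hg : x⁻¹ * (x * (h : G)) ∈ H, (⟨x⁻¹ * (x * (h : G)), hg⟩ : H) ∈ Ψ₁)) ↔ h ∈ Ψ₁ := by
  constructor
  · rintro (⟨hg, -⟩ | ⟨hg, hm⟩)
    · exact absurd hg (mul_coe_not_mem hx h)
    · simpa [inv_mul_cancel_left] using hm
  · intro hm
    exact Or.inr ⟨by simp [inv_mul_cancel_left], by simpa [inv_mul_cancel_left] using hm⟩

omit [Fintype G] [DecidableEq G] [DecidablePred (· ∈ H)] in
/-- Every element of `G ∖ H` is `x·h`. [folklore] -/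
theorem exists_eq_mul_of_not_mem (hH : H.index = 2) {x : G} (hx : x ∉ H) {g : G} (hg : g ∉ H) : ∃ h : H, g = x * (h : G) :=
  ⟨⟨x⁻¹ * g, (inv_mul_mem_iff_not_mem hH hx g).mpr hg⟩, by simp [mul_inv_cancel_left]⟩

/-- **Gluing** two CM types of `(H, c)` along the cosets: `glue Ψ₀ Ψ₁ = Ψ₀ ⊔ x·Ψ₁`, a CM type of `(G, c)`. [folklore] -/
def glue (hcH : c ∈ H) (hcen : ∀ g : G, g * c = c * g) (hH : H.index = 2) {x : G} (hx : x ∉ H) (Ψ₀ Ψ₁ : CMF H ⟨c, hcH⟩) : CMF G c := by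
  classical
  refine ⟨univ.filter fun g => (∃ hg : g ∈ H, (⟨g, hg⟩ : H) ∈ Ψ₀.1) ∨ (∃ hg : x⁻¹ * g ∈ H, (⟨x⁻¹ * g, hg⟩ : H) ∈ Ψ₁.1),
    fun g => ?_⟩
  simp only [mem_filter, mem_univ, true_and]
  by_cases hg : g ∈ H
  · have h0 := glueMem_coe_iff hH hx Ψ₀.1 Ψ₁.1 ⟨g, hg⟩
    have h1 := glueMem_coe_iff hH hx Ψ₀.1 Ψ₁.1 (⟨c, hcH⟩ * ⟨g, hg⟩)
    simp only [Subgroup.coe_mul] at h0 h1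
    rw [h0, h1]
    exact Ψ₀.2 ⟨g, hg⟩
  · obtain ⟨h, rfl⟩ := exists_eq_mul_of_not_mem hH hx hg
    have h1 := glueMem_mul_iff hx Ψ₀.1 Ψ₁.1 (⟨c, hcH⟩ * h)
    simp only [Subgroup.coe_mul] at h1
    rw [glueMem_mul_iff hx, ← mul_assoc c x, ← hcen x, mul_assoc, h1]
    exact Ψ₁.2 h

/-- Membership of an element of `H` in a glued type. [folklore] -/
theorem mem_glue_coe (hcH : c ∈ H) (hcen : ∀ g : G, g * c = c * g) (hH : H.index = 2) {x : G} (hx : x ∉ H)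
    (Ψ₀ Ψ₁ : CMF H ⟨c, hcH⟩) (h : H) : (h : G) ∈ (glue hcH hcen hH hx Ψ₀ Ψ₁).1 ↔ h ∈ Ψ₀.1 := by
  classical
  unfold glue
  simp only [mem_filter, mem_univ, true_and]
  exact glueMem_coe_iff hH hx Ψ₀.1 Ψ₁.1 h

/-- Membership of an element of `xH` in a glued type. [folklore] -/
theorem mem_glue_mul (hcH : c ∈ H) (hcen : ∀ g : G, g * c = c * g) (hH : H.index = 2) {x : G} (hx : x ∉ H)
    (Ψ₀ Ψ₁ : CMF H ⟨c, hcH⟩) (h : H) : x * (h : G) ∈ (glue hcH hcen hH hx Ψ₀ Ψ₁).1 ↔ h ∈ Ψ₁.1 := by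
  classical
  unfold glue
  simp only [mem_filter, mem_univ, true_and]
  exact glueMem_mul_iff hx Ψ₀.1 Ψ₁.1 h

/-- Two CM types of `(G, c)` with the same two parts are equal. [folklore] -/
theorem ext_of_res (hcH : c ∈ H) (hcen : ∀ g : G, g * c = c * g) (hH : H.index = 2) {x : G} (hx : x ∉ H) {Ψ Ψ' : CMF G c}
    (h0 : res₀ hcH Ψ = res₀ hcH Ψ') (h1 : res₁ hcH hcen x Ψ = res₁ hcH hcen x Ψ') : Ψ = Ψ' := by
  apply Subtype.ext
  ext g
  by_cases hg : g ∈ H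
  · have := congrArg (fun T : CMF H ⟨c, hcH⟩ => (⟨g, hg⟩ : H) ∈ T.1) h0
    simpa using this
  · obtain ⟨h, rfl⟩ := exists_eq_mul_of_not_mem hH hx hg
    have := congrArg (fun T : CMF H ⟨c, hcH⟩ => h ∈ T.1) h1
    simpa using this

/-- `res₀ (glue Ψ₀ Ψ₁) = Ψ₀`. [folklore] -/
theorem res₀_glue (hcH : c ∈ H) (hcen : ∀ g : G, g * c = c * g) (hH : H.index = 2) {x : G} (hx : x ∉ H) (Ψ₀ Ψ₁ : CMF H ⟨c, hcH⟩) :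
    res₀ hcH (glue hcH hcen hH hx Ψ₀ Ψ₁) = Ψ₀ := by
  apply Subtype.ext; ext h
  rw [mem_res₀, mem_glue_coe]

/-- `res₁ (glue Ψ₀ Ψ₁) = Ψ₁`. [folklore] -/
theorem res₁_glue (hcH : c ∈ H) (hcen : ∀ g : G, g * c = c * g) (hH : H.index = 2) {x : G} (hx : x ∉ H) (Ψ₀ Ψ₁ : CMF H ⟨c, hcH⟩) :
    res₁ hcH hcen x (glue hcH hcen hH hx Ψ₀ Ψ₁) = Ψ₁ := by
  apply Subtype.ext; ext h
  rw [mem_res₁, mem_glue_mul]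

/-- `glue (res₀ Ψ) (res₁ Ψ) = Ψ`. [folklore] -/
theorem glue_res (hcH : c ∈ H) (hcen : ∀ g : G, g * c = c * g) (hH : H.index = 2) {x : G} (hx : x ∉ H) (Ψ : CMF G c) :
    glue hcH hcen hH hx (res₀ hcH Ψ) (res₁ hcH hcen x Ψ) = Ψ :=
  ext_of_res hcH hcen hH hx (res₀_glue hcH hcen hH hx _ _) (res₁_glue hcH hcen hH hx _ _)

/-- **THE DICTIONARY OF INDEX-TWO DESCENT**: `CMF G c ≃ CMF H c × CMF H c`, `Ψ ↦ (Ψ ∩ H, x⁻¹(Ψ ∩ xH))`. [folklore] -/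
def typePairEquiv (hcH : c ∈ H) (hcen : ∀ g : G, g * c = c * g) (hH : H.index = 2) {x : G} (hx : x ∉ H) :
    CMF G c ≃ CMF H ⟨c, hcH⟩ × CMF H ⟨c, hcH⟩ where
  toFun Ψ := (res₀ hcH Ψ, res₁ hcH hcen x Ψ)
  invFun p := glue hcH hcen hH hx p.1 p.2
  left_inv Ψ := glue_res hcH hcen hH hx Ψ
  right_inv p := Prod.ext (res₀_glue hcH hcen hH hx p.1 p.2) (res₁_glue hcH hcen hH hx p.1 p.2)

/-- `typePairEquiv Ψ = (res₀ Ψ, res₁ Ψ)`. [folklore] -/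
@[simp] theorem typePairEquiv_apply (hcH : c ∈ H) (hcen : ∀ g : G, g * c = c * g) (hH : H.index = 2) {x : G} (hx : x ∉ H)
    (Ψ : CMF G c) : typePairEquiv hcH hcen hH hx Ψ = (res₀ hcH Ψ, res₁ hcH hcen x Ψ) := rfl

/-- `typePairEquiv⁻¹ (Ψ₀, Ψ₁) = glue Ψ₀ Ψ₁`. [folklore] -/
@[simp] theorem typePairEquiv_symm_apply (hcH : c ∈ H) (hcen : ∀ g : G, g * c = c * g) (hH : H.index = 2) {x : G} (hx : x ∉ H)
    (p : CMF H ⟨c, hcH⟩ × CMF H ⟨c, hcH⟩) : (typePairEquiv hcH hcen hH hx).symm p = glue hcH hcen hH hx p.1 p.2 := rfl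

/-- **Counting**: `#CMF G c = (#CMF H c)²`. [folklore] -/
theorem card_cmf_eq_sq (hcH : c ∈ H) [Fintype (CMF G c)] [Fintype (CMF H ⟨c, hcH⟩)] (hcen : ∀ g : G, g * c = c * g)
    (hH : H.index = 2) {x : G} (hx : x ∉ H) : Fintype.card (CMF G c) = Fintype.card (CMF H ⟨c, hcH⟩) ^ 2 := by
  rw [Fintype.card_congr (typePairEquiv hcH hcen hH hx), Fintype.card_prod, sq]

/-! ## §3 Base change under the splitting -/

/-- Raw form: `h ∈ res₀ (Ψ·Q⁻¹) ↔ h·Q ∈ Ψ`. [folklore] -/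
theorem coe_mem_res₀_rt_iff (hcH : c ∈ H) (Q : G) (Ψ : CMF G c) (h : H) : h ∈ (res₀ hcH (rt c Q Ψ)).1 ↔ (h : G) * Q ∈ Ψ.1 := by
  rw [mem_res₀, mem_rt]

/-- Raw form: `h ∈ res₁ (Ψ·Q⁻¹) ↔ x·h·Q ∈ Ψ`. [folklore] -/
theorem mem_res₁_rt_iff (hcH : c ∈ H) (hcen : ∀ g : G, g * c = c * g) (x Q : G) (Ψ : CMF G c) (h : H) :
    h ∈ (res₁ hcH hcen x (rt c Q Ψ)).1 ↔ x * (h : G) * Q ∈ Ψ.1 := by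
  rw [mem_res₁, mem_rt]

/-- **Base change along `H` is diagonal, `0`-coordinate**: `res₀ (Ψ·Q⁻¹) = (res₀ Ψ)·Q⁻¹` for `Q ∈ H`. [folklore] -/
theorem res₀_rt_coe (hcH : c ∈ H) (Q : H) (Ψ : CMF G c) : res₀ hcH (rt c (Q : G) Ψ) = rt (⟨c, hcH⟩ : H) Q (res₀ hcH Ψ) := by
  apply Subtype.ext; ext h
  rw [coe_mem_res₀_rt_iff, mem_rt, mem_res₀, Subgroup.coe_mul]

/-- **Base change along `H` is diagonal, `1`-coordinate**: `res₁ (Ψ·Q⁻¹) = (res₁ Ψ)·Q⁻¹` for `Q ∈ H`. [folklore] -/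
theorem res₁_rt_coe (hcH : c ∈ H) (hcen : ∀ g : G, g * c = c * g) (x : G) (Q : H) (Ψ : CMF G c) :
    res₁ hcH hcen x (rt c (Q : G) Ψ) = rt (⟨c, hcH⟩ : H) Q (res₁ hcH hcen x Ψ) := by
  apply Subtype.ext; ext h
  rw [mem_res₁_rt_iff, mem_rt, mem_res₁, Subgroup.coe_mul, mul_assoc]

/-- **Conjugation is diagonal, `0`-coordinate**: `res₀ (Ψ·c) = (res₀ Ψ)·c`. [folklore] -/
theorem res₀_rt_self (hcH : c ∈ H) (Ψ : CMF G c) : res₀ hcH (rt c c Ψ) = rt (⟨c, hcH⟩ : H) ⟨c, hcH⟩ (res₀ hcH Ψ) :=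
  res₀_rt_coe hcH ⟨c, hcH⟩ Ψ

/-- **Conjugation is diagonal, `1`-coordinate**: `res₁ (Ψ·c) = (res₁ Ψ)·c`. [folklore] -/
theorem res₁_rt_self (hcH : c ∈ H) (hcen : ∀ g : G, g * c = c * g) (x : G) (Ψ : CMF G c) :
    res₁ hcH hcen x (rt c c Ψ) = rt (⟨c, hcH⟩ : H) ⟨c, hcH⟩ (res₁ hcH hcen x Ψ) :=
  res₁_rt_coe hcH hcen x ⟨c, hcH⟩ Ψ

/-- **Base change along `x`, `1`-coordinate**: `h ∈ res₁ (Ψ·x⁻¹) ↔ x·h·x ∈ Ψ ↔ (x h x⁻¹)·x² ∈ res₀ Ψ` — the coordinates swap up to `x`-conjugation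
and the `x²`-shift (raw form). [folklore] -/
theorem mem_res₁_rt_x_iff (hcH : c ∈ H) (hcen : ∀ g : G, g * c = c * g) (x : G) (Ψ : CMF G c) (h : H) :
    h ∈ (res₁ hcH hcen x (rt c x Ψ)).1 ↔ x * (h : G) * x⁻¹ * (x * x) ∈ Ψ.1 := by
  rw [mem_res₁_rt_iff]
  simp only [mul_assoc, inv_mul_cancel_left]

/-- **Base change along `x`, `0`-coordinate**: `h ∈ res₀ (Ψ·x⁻¹) ↔ h·x ∈ Ψ ↔ x⁻¹ h x ∈ res₁ Ψ` (raw form). [folklore] -/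
theorem coe_mem_res₀_rt_x_iff (hcH : c ∈ H) (x : G) (Ψ : CMF G c) (h : H) :
    h ∈ (res₀ hcH (rt c x Ψ)).1 ↔ x * (x⁻¹ * (h : G) * x) ∈ Ψ.1 := by
  rw [coe_mem_res₀_rt_iff]
  simp only [← mul_assoc, mul_inv_cancel, one_mul]

/-! ## §4 Flips under the splitting -/

omit [Fintype G] [DecidablePred (· ∈ H)] in
/-- The place of `t ∈ H` in `G`, seen from `H`: `(h : G) ∈ {t, ct} ↔ h ∈ {t, c t}` in `H`. [folklore] -/
theorem coe_mem_orb_coe_iff (hcH : c ∈ H) (t h : H) : (h : G) ∈ orb c (t : G) ↔ h ∈ orb (⟨c, hcH⟩ : H) t := by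
  rw [mem_orb, mem_orb]
  constructor
  · rintro (h1 | h1)
    · exact Or.inl (Subtype.ext h1)
    · exact Or.inr (Subtype.ext (by simpa using h1))
  · rintro (rfl | rfl)
    · exact Or.inl rfl
    · exact Or.inr (by simp)

omit [Fintype G] [DecidablePred (· ∈ H)] in
/-- An element of `xH` is not at a place of `H`. [folklore] -/
theorem mul_coe_not_mem_orb_coe (hcH : c ∈ H) {x : G} (hx : x ∉ H) (t h : H) : x * (h : G) ∉ orb c (t : G) := by
  rw [mem_orb]
  rintro (h1 | h1)
  · exact mul_coe_not_mem hx h (h1 ▸ t.2)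
  · exact mul_coe_not_mem hx h (h1 ▸ H.mul_mem hcH t.2)

omit [Fintype G] [DecidablePred (· ∈ H)] in
/-- An element of `H` is not at a place of `xH`. [folklore] -/
theorem coe_not_mem_orb_mul (hcH : c ∈ H) (hcen : ∀ g : G, g * c = c * g) {x : G} (hx : x ∉ H) (t h : H) :
    (h : G) ∉ orb c (x * (t : G)) := by
  rw [mem_orb]
  rintro (h1 | h1)
  · exact mul_coe_not_mem hx t (h1 ▸ h.2)
  · refine mul_coe_not_mem hx (⟨c, hcH⟩ * t) ?_
    rw [Subgroup.coe_mul, ← mul_assoc, hcen x, mul_assoc, ← h1]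
    exact h.2

omit [Fintype G] [DecidablePred (· ∈ H)] in
/-- The place of `x·t` in `G`, seen from `H` through `x`: `x·h ∈ {xt, cxt} ↔ h ∈ {t, ct}`. [folklore] -/
theorem mul_coe_mem_orb_mul_iff (hcH : c ∈ H) (hcen : ∀ g : G, g * c = c * g) (x : G) (t h : H) :
    x * (h : G) ∈ orb c (x * (t : G)) ↔ h ∈ orb (⟨c, hcH⟩ : H) t := by
  rw [mem_orb, mem_orb, ← mul_assoc c x, ← hcen x, mul_assoc]
  constructor
  · rintro (h1 | h1)
    · exact Or.inl (Subtype.ext (mul_left_cancel h1))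
    · exact Or.inr (Subtype.ext (by simpa using mul_left_cancel h1))
  · rintro (rfl | rfl)
    · exact Or.inl rfl
    · exact Or.inr (by simp)

/-- **A flip at a place of `H` flips the `0`-coordinate**: `res₀ (Ψ^{(t)}) = (res₀ Ψ)^{(t)}`. [folklore] -/
theorem res₀_oflipCM_coe (hcH : c ∈ H) (hc2 : c * c = 1) (t : H) (Ψ : CMF G c) :
    res₀ hcH (oflipCM c hc2 (t : G) Ψ) = oflipCM ⟨c, hcH⟩ (csub_mul_csub hcH hc2) t (res₀ hcH Ψ) := by
  apply Subtype.ext; ext h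
  rw [mem_res₀]
  show (h : G) ∈ oflip c (t : G) Ψ.1 ↔ h ∈ oflip (⟨c, hcH⟩ : H) t (res₀ hcH Ψ).1
  rw [oflip, oflip, Finset.mem_symmDiff, Finset.mem_symmDiff, mem_res₀, coe_mem_orb_coe_iff hcH]

/-- **… and leaves the `1`-coordinate**: `res₁ (Ψ^{(t)}) = res₁ Ψ` for `t ∈ H`. [folklore] -/
theorem res₁_oflipCM_coe (hcH : c ∈ H) (hcen : ∀ g : G, g * c = c * g) (hc2 : c * c = 1) {x : G} (hx : x ∉ H) (t : H) (Ψ : CMF G c) :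
    res₁ hcH hcen x (oflipCM c hc2 (t : G) Ψ) = res₁ hcH hcen x Ψ := by
  apply Subtype.ext; ext h
  rw [mem_res₁, mem_res₁]
  show x * (h : G) ∈ oflip c (t : G) Ψ.1 ↔ _
  rw [oflip, Finset.mem_symmDiff]
  have hn := mul_coe_not_mem_orb_coe hcH hx t h
  tauto

/-- **A flip at a place of `xH` leaves the `0`-coordinate**: `res₀ (Ψ^{(xt)}) = res₀ Ψ`. [folklore] -/
theorem res₀_oflipCM_mul (hcH : c ∈ H) (hcen : ∀ g : G, g * c = c * g) (hc2 : c * c = 1) {x : G} (hx : x ∉ H) (t : H) (Ψ : CMF G c) :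
    res₀ hcH (oflipCM c hc2 (x * (t : G)) Ψ) = res₀ hcH Ψ := by
  apply Subtype.ext; ext h
  rw [mem_res₀, mem_res₀]
  show (h : G) ∈ oflip c (x * (t : G)) Ψ.1 ↔ _
  rw [oflip, Finset.mem_symmDiff]
  have hn := coe_not_mem_orb_mul hcH hcen hx t h
  tauto

/-- **… and flips the `1`-coordinate**: `res₁ (Ψ^{(xt)}) = (res₁ Ψ)^{(t)}`. [folklore] -/
theorem res₁_oflipCM_mul (hcH : c ∈ H) (hcen : ∀ g : G, g * c = c * g) (hc2 : c * c = 1) (x : G) (t : H) (Ψ : CMF G c) :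
    res₁ hcH hcen x (oflipCM c hc2 (x * (t : G)) Ψ) = oflipCM ⟨c, hcH⟩ (csub_mul_csub hcH hc2) t (res₁ hcH hcen x Ψ) := by
  apply Subtype.ext; ext h
  rw [mem_res₁]
  show x * (h : G) ∈ oflip c (x * (t : G)) Ψ.1 ↔ h ∈ oflip (⟨c, hcH⟩ : H) t (res₁ hcH hcen x Ψ).1
  rw [oflip, oflip, Finset.mem_symmDiff, Finset.mem_symmDiff, mem_res₁, mul_coe_mem_orb_mul_iff hcH hcen]

end

end Summit.HodgeConjecture.CorCM.Census.IndexTwoDescent
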